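import Mathlib
import Summits.ResolutionOfSingularities.ResolutionOfSingularities.Theorems.RadicialJungCleanModelsLens5TFrameLayer
import HarnessLib

/-!
# Route `RadicialJung`, crux `CleanModels` (stmt-15917): T⁗ port part 7/13 — §G⁗.B (second half): dimension, regularity and regular parameters of the frame extension (source :2003–2206)

PORT (line lead `res-B-lead-1` g8, for Sketch rev 32) of res-B-lens-5's crux workfiles `Cruxes/DescentPerfectToAll/Lens5_TFrame.lean` rev 4
(crux ae884a356928; author res-B-lens-5 g15; `lean check` rc 0 · 0 sorries · 0 warnings; crit-1 TRIAGE-146/150 PASS) and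
`Cruxes/DescentPerfectToAll/Lens5_PDegreeCount.lean` rev 3 (crux 100289d6413b; TRIAGE-151 PASS): THEOREMS T⁗ / T⁗′ / T⁗″ / T⁗‴ — the slice
{`[Γ:pΓ] = p²`, `k` of FINITE `p`-rank `r`, `[κ_v : κ_v^p] = p^r`} of the research stub `stub_cleanLU3DefectNonDiscrete` (valuations of MINIMAL
Frobenius defect `d(K|K^p, v) = p`, ANY such ground field: no perfectness, no separability of `K/k` or `κ_v/k`), modulo F-02 `CossartPiltant2019` and
F-32 (`hEmb`) only.  The port is split into def-free modules `…Lens5TFrame{RG,IR,Graded,Port2,Port4Core,Layer,Layer2,Port4,Composition,PMon,PDegreeA,PDegreeB,PDegreeC}`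
over ONE currency module `…Lens5TFrameCurrency` (the authors' `def`s, verbatim); declarations VERBATIM, namespace
`Summit.ResolutionOfSingularities.ResolutionOfSingularities.Theorems.RadicialJungCleanModels.Lens5TFrame` (the authors' §A copy of
`Lens5_PDegreeSep` and the constant-frame corollaries `cleanLU3DefectPRankTwoSepFin_of_frame` / `…SepFin_of_cossartPiltant2019'` are not ported).
OURS · counted 0 · nothing here proves resolution in characteristic `p`.


-/

set_option linter.dupNamespace false -- mandated namespace of this single-conjunct summit

section

open IsLocalRing
open Literature.AlgebraicGeometry.Resolution
open Summit.ResolutionOfSingularities.ResolutionOfSingularities.Theorems.RadicialJung.CleanModels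
open Summit.ResolutionOfSingularities.ResolutionOfSingularities.Theorems.RadicialJung.CleanModels.Lens5
open Summit.ResolutionOfSingularities.ResolutionOfSingularities.Theorems.RadicialJung.CleanModels.Lens5.PRankTwoCurrency
open Summit.ResolutionOfSingularities.ResolutionOfSingularities.Theorems.RadicialJung.CleanModels.Lens5.PRankTwoAssembly
open Summit.ResolutionOfSingularities.ResolutionOfSingularities.Theorems.RadicialJungCleanModels.Lens5RegularityCriterion
open Summit.ResolutionOfSingularities.ResolutionOfSingularities.Theorems.RadicialJungCleanModels.Lens5ChartSurjection

namespace Summit.ResolutionOfSingularities.ResolutionOfSingularities.Theorems.RadicialJungCleanModels.Lens5TFrame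

section FrameLayer2

variable {K : Type} [Field K] {ι : Type} [Fintype ι] (O : ValuationSubring K)

/-- (dimension) `S = locAtCentre A'' O` is finite (free) over `S₀ = locAtCentre A₀ O`, hence integral: equal Krull dimensions. -/
theorem ringKrullDim_eq_of_frame {k : Type} [Field k] [Algebra k K] {A₀ A'' : Subalgebra k K}
    (hA''O : A''.toSubring ≤ O.toSubring) (h0le : A₀ ≤ A'')
    {W : ι → K} (hWA'' : ∀ s, W s ∈ A'') (hWv : ∀ s, O.valuation (W s) = 1)
    (RG₀ : ∀ e : ι → K, (∀ s, e s ∈ locAtCentre A₀.toSubring O) →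
      ∀ s₀, O.valuation (e s₀ * W s₀) ≤ O.valuation (∑ s, e s * W s))
    (hgenN : ∀ a ∈ A'', HasExp (locAtCentre A₀.toSubring O) W a) :
    ringKrullDim (locAtCentre A₀.toSubring O) = ringKrullDim (locAtCentre A''.toSubring O) := by
  classical
  have hle : locAtCentre A₀.toSubring O ≤ locAtCentre A''.toSubring O :=
    locAtCentre_mono O (fun x hx => h0le hx)
  set S₀ : Subring K := locAtCentre A₀.toSubring O with hS₀def
  set S : Subring K := locAtCentre A''.toSubring O with hSdef
  have hWS : ∀ s, W s ∈ S := fun s => le_locAtCentre _ O (hWA'' s)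
  letI : Algebra S₀ S := (Subring.inclusion hle).toAlgebra
  haveI : Module.Finite S₀ S := by
    refine ⟨⟨Finset.univ.image (fun s => (⟨W s, hWS s⟩ : S)), ?_⟩⟩
    rw [eq_top_iff]
    rintro a -
    obtain ⟨e, heS, hea⟩ := hasExp_of_mem_locAtCentre O hA''O h0le hWA'' hWv RG₀ hgenN a.2
    have ha : a = ∑ s, (⟨e s, heS s⟩ : S₀) • (⟨W s, hWS s⟩ : S) := by
      apply Subtype.ext
      rw [hea]
      change _ = S.subtype (∑ s, _)
      rw [map_sum]
      refine Finset.sum_congr rfl fun s _ => ?_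
      rw [Algebra.smul_def]
      rfl
    rw [ha]
    exact Submodule.sum_mem _ fun s _ => Submodule.smul_mem _ _
      (Submodule.subset_span (Finset.mem_coe.mpr (Finset.mem_image_of_mem _ (Finset.mem_univ s))))
  have hinj : Function.Injective (algebraMap S₀ S) := fun a b h =>
    Subtype.ext (by have := congrArg (fun x : S => (x : K)) h; exact this)
  exact Literature.RingTheory.KrullDimension.ringKrullDim_eq_of_isIntegral hinj

/-- (F3)+(F4) `𝔪_S = 𝔪_{S₀} S`, so `S` is regular when `S₀` is (equal dimensions). -/
theorem isRegularLocalRing_of_frame {k : Type} [Field k] [Algebra k K] {A₀ A'' : Subalgebra k K}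
    (hA''O : A''.toSubring ≤ O.toSubring) (h0le : A₀ ≤ A'') (hA''fg : A''.FG)
    {W : ι → K} (hWA'' : ∀ s, W s ∈ A'') (hWv : ∀ s, O.valuation (W s) = 1)
    (RG₀ : ∀ e : ι → K, (∀ s, e s ∈ locAtCentre A₀.toSubring O) →
      ∀ s₀, O.valuation (e s₀ * W s₀) ≤ O.valuation (∑ s, e s * W s))
    (hgenN : ∀ a ∈ A'', HasExp (locAtCentre A₀.toSubring O) W a)
    [hreg₀ : IsRegularLocalRing (locAtCentre A₀.toSubring O)] :
    IsRegularLocalRing (locAtCentre A''.toSubring O) := by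
  classical
  have hA₀O : A₀.toSubring ≤ O.toSubring := fun x hx => hA''O (h0le hx)
  have hle : locAtCentre A₀.toSubring O ≤ locAtCentre A''.toSubring O :=
    locAtCentre_mono O (fun x hx => h0le hx)
  set S₀ : Subring K := locAtCentre A₀.toSubring O with hS₀def
  set S : Subring K := locAtCentre A''.toSubring O with hSdef
  have hWS : ∀ s, W s ∈ S := fun s => le_locAtCentre _ O (hWA'' s)
  haveI hSloc : IsLocalRing S := isLocalRing_locAtCentre hA''O
  haveI : IsLocalization.AtPrime S (subringCentre A''.toSubring O hA''O) := isLocalization_locAtCentre hA''O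
  letI : Algebra k A''.toSubring := inferInstanceAs (Algebra k A'')
  haveI : Algebra.FiniteType k A''.toSubring := (A''.fg_iff_finiteType.mp hA''fg : Algebra.FiniteType k A'')
  haveI hSnoeth : IsNoetherianRing S :=
    IsLocalization.isNoetherianRing (subringCentre A''.toSubring O hA''O).primeCompl S
      (Algebra.FiniteType.isNoetherianRing k A''.toSubring)
  obtain ⟨G₀, hG₀card, hG₀span⟩ := Submodule.FG.exists_span_finset_card_eq_spanFinrank
    (IsNoetherian.noetherian (IsLocalRing.maximalIdeal S₀))
  set ιh : S₀ →+* S := Subring.inclusion hle with hιhdef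
  have hmS : IsLocalRing.maximalIdeal S = Ideal.span ((G₀.image ιh : Finset S) : Set S) := by
    apply le_antisymm
    · intro a ha
      have hva : O.valuation (a : K) < 1 := (mem_maximalIdeal_locAtCentre_iff hA''O a).mp ha
      obtain ⟨e, heS, hea⟩ := hasExp_of_mem_locAtCentre O hA''O h0le hWA'' hWv RG₀ hgenN a.2
      rw [hea] at hva
      have hve := (valuation_exp_lt_one_iff O hWv RG₀ heS).mp hva
      have hmem : ∀ s, ιh ⟨e s, heS s⟩ ∈ Ideal.span ((G₀.image ιh : Finset S) : Set S) := by
        intro s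
        have h1 : (⟨e s, heS s⟩ : S₀) ∈ IsLocalRing.maximalIdeal S₀ :=
          (mem_maximalIdeal_locAtCentre_iff hA₀O _).mpr (hve s)
        rw [← hG₀span] at h1
        have h2 := Ideal.mem_map_of_mem ιh h1
        rw [Ideal.map_span] at h2
        rw [Finset.coe_image]
        exact h2
      have ha' : a = ∑ s, ιh ⟨e s, heS s⟩ * ⟨W s, hWS s⟩ := by
        apply Subtype.ext
        rw [hea]
        change _ = S.subtype (∑ s, _)
        rw [map_sum]
        exact Finset.sum_congr rfl fun s _ => rfl
      rw [ha']
      exact Ideal.sum_mem _ fun s _ => Ideal.mul_mem_right _ _ (hmem s)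
    · rw [Ideal.span_le]
      intro x hx
      obtain ⟨g, hg, rfl⟩ := Finset.mem_image.mp (Finset.mem_coe.mp hx)
      have hg1 : g ∈ IsLocalRing.maximalIdeal S₀ := by
        rw [← hG₀span]; exact Ideal.subset_span (Finset.mem_coe.mpr hg)
      exact (mem_maximalIdeal_locAtCentre_iff hA''O _).mpr ((mem_maximalIdeal_locAtCentre_iff hA₀O g).mp hg1)
  have hdimeq := ringKrullDim_eq_of_frame O hA''O h0le hWA'' hWv RG₀ hgenN
  apply IsRegularLocalRing.of_spanFinrank_maximalIdeal_le
  rw [← hdimeq, ← hreg₀.spanFinrank_maximalIdeal, ← hG₀card, hmS]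
  exact_mod_cast (Submodule.spanFinrank_span_le_ncard_of_finite (Finset.finite_toSet _)).trans
    (by rw [Set.ncard_coe_finset]; exact Finset.card_image_le)

/-- (F5) a regular parameter of `S₀` stays a regular parameter of `S = ⊕ W_s S₀` (freeness + a unit coordinate of `1`). -/
theorem regularParameter_of_frame {k : Type} [Field k] [Algebra k K] {A₀ A'' : Subalgebra k K}
    (hA''O : A''.toSubring ≤ O.toSubring) (h0le : A₀ ≤ A'')
    {W : ι → K} (hWA'' : ∀ s, W s ∈ A'') (hWv : ∀ s, O.valuation (W s) = 1)
    (RG₀ : ∀ e : ι → K, (∀ s, e s ∈ locAtCentre A₀.toSubring O) →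
      ∀ s₀, O.valuation (e s₀ * W s₀) ≤ O.valuation (∑ s, e s * W s))
    (hgenN : ∀ a ∈ A'', HasExp (locAtCentre A₀.toSubring O) W a)
    [hreg₀ : IsRegularLocalRing (locAtCentre A₀.toSubring O)]
    [hregS : IsRegularLocalRing (locAtCentre A''.toSubring O)]
    (ψ₀ : locAtCentre A₀.toSubring O) (hψ1 : ψ₀ ∈ IsLocalRing.maximalIdeal (locAtCentre A₀.toSubring O))
    (hψ2 : ψ₀ ∉ (IsLocalRing.maximalIdeal (locAtCentre A₀.toSubring O)) ^ 2)
    (ψ : locAtCentre A''.toSubring O) (hψψ₀ : (ψ : K) = ψ₀) :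
    ψ ∈ IsLocalRing.maximalIdeal (locAtCentre A''.toSubring O) ∧
      ψ ∉ (IsLocalRing.maximalIdeal (locAtCentre A''.toSubring O)) ^ 2 := by
  classical
  have hA₀O : A₀.toSubring ≤ O.toSubring := fun x hx => hA''O (h0le hx)
  have hS₀O : (locAtCentre A₀.toSubring O) ≤ O.toSubring := locAtCentre_le hA₀O
  have coe_sum : ∀ f : ι → (locAtCentre A₀.toSubring O), (((∑ t, f t : (locAtCentre A₀.toSubring O))) : K) = ∑ t, (f t : K) := fun f => map_sum (locAtCentre A₀.toSubring O).subtype f Finset.univ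
  refine ⟨(mem_maximalIdeal_locAtCentre_iff hA''O _).mpr
    (by rw [hψψ₀]; exact (mem_maximalIdeal_locAtCentre_iff hA₀O ψ₀).mp hψ1), fun h => ?_⟩
  -- every element of `𝔪_S²` has an expansion with coefficients in `𝔪_{(locAtCentre A₀.toSubring O)}²`
  choose d hdS hd using fun s t => hgenN (W s * W t) (A''.mul_mem (hWA'' s) (hWA'' t))
  have hQ : ∀ m ∈ (IsLocalRing.maximalIdeal (locAtCentre A''.toSubring O)) ^ 2, ∃ e : ι → (locAtCentre A₀.toSubring O),
      (∀ s, e s ∈ (IsLocalRing.maximalIdeal (locAtCentre A₀.toSubring O)) ^ 2) ∧ ((m : (locAtCentre A''.toSubring O)) : K) = ∑ s, (e s : K) * W s := by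
    intro m hm
    rw [pow_two] at hm
    refine Submodule.mul_induction_on hm ?_ ?_
    · intro m hm n hn
      obtain ⟨a, haS, hma⟩ := hasExp_of_mem_locAtCentre O hA''O h0le hWA'' hWv RG₀ hgenN m.2
      obtain ⟨b, hbS, hnb⟩ := hasExp_of_mem_locAtCentre O hA''O h0le hWA'' hWv RG₀ hgenN n.2
      have hva : ∀ s, O.valuation (a s) < 1 := (valuation_exp_lt_one_iff O hWv RG₀ haS).mp
        (by rw [← hma]; exact (mem_maximalIdeal_locAtCentre_iff hA''O m).mp hm)
      have hvb : ∀ s, O.valuation (b s) < 1 := (valuation_exp_lt_one_iff O hWv RG₀ hbS).mp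
        (by rw [← hnb]; exact (mem_maximalIdeal_locAtCentre_iff hA''O n).mp hn)
      refine ⟨fun u => ∑ s, ∑ t, (⟨a s, haS s⟩ * ⟨b t, hbS t⟩ : (locAtCentre A₀.toSubring O)) * ⟨d s t u, hdS s t u⟩, fun u => ?_, ?_⟩
      · refine Ideal.sum_mem _ fun s _ => Ideal.sum_mem _ fun t _ => Ideal.mul_mem_right _ _ ?_
        rw [pow_two]
        exact Ideal.mul_mem_mul ((mem_maximalIdeal_locAtCentre_iff hA₀O _).mpr (hva s))
          ((mem_maximalIdeal_locAtCentre_iff hA₀O _).mpr (hvb t))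
      · have hR : ∀ u, ((∑ s, ∑ t, (⟨a s, haS s⟩ * ⟨b t, hbS t⟩ : (locAtCentre A₀.toSubring O)) * ⟨d s t u, hdS s t u⟩ : (locAtCentre A₀.toSubring O)) : K) =
            ∑ s, ∑ t, a s * b t * d s t u := by
          intro u
          rw [coe_sum]
          refine Finset.sum_congr rfl fun s _ => ?_
          rw [coe_sum]
          rfl
        simp_rw [hR]
        change (m : K) * (n : K) = _
        rw [hma, hnb, Finset.sum_mul_sum]
        calc ∑ s, ∑ t, a s * W s * (b t * W t) = ∑ s, ∑ t, a s * b t * (W s * W t) :=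
              Finset.sum_congr rfl fun s _ => Finset.sum_congr rfl fun t _ => by ring
          _ = ∑ s, ∑ t, ∑ u, a s * b t * d s t u * W u := by
              refine Finset.sum_congr rfl fun s _ => Finset.sum_congr rfl fun t _ => ?_
              rw [hd s t, Finset.mul_sum]
              exact Finset.sum_congr rfl fun u _ => by ring
          _ = ∑ s, ∑ u, ∑ t, a s * b t * d s t u * W u :=
              Finset.sum_congr rfl fun s _ => Finset.sum_comm
          _ = ∑ u, ∑ s, ∑ t, a s * b t * d s t u * W u := Finset.sum_comm
          _ = ∑ u, (∑ s, ∑ t, a s * b t * d s t u) * W u := by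
              refine Finset.sum_congr rfl fun u _ => ?_
              rw [Finset.sum_mul]
              exact Finset.sum_congr rfl fun s _ => by rw [Finset.sum_mul]
    · rintro x y ⟨e, he, hx⟩ ⟨f, hf, hy⟩
      refine ⟨fun s => e s + f s, fun s => Ideal.add_mem _ (he s) (hf s), ?_⟩
      change (x : K) + (y : K) = _
      rw [hx, hy, ← Finset.sum_add_distrib]
      exact Finset.sum_congr rfl fun s _ => by rw [Subring.coe_add]; ring
  obtain ⟨e, he2, hψe⟩ := hQ ψ h
  rw [hψψ₀] at hψe
  obtain ⟨ε, hεS, hε1⟩ := hgenN 1 A''.one_mem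
  -- uniqueness of coefficients: `e_s = ψ₀ ε_s`
  have hdiff : ∀ s, (e s : K) - (ψ₀ : K) * ε s = 0 :=
    hasExp_unique O hWv RG₀ (e := fun s => (e s : K) - (ψ₀ : K) * ε s)
      (fun s => (locAtCentre A₀.toSubring O).sub_mem (e s).2 ((locAtCentre A₀.toSubring O).mul_mem ψ₀.2 (hεS s))) (by
        simp_rw [sub_mul, Finset.sum_sub_distrib, mul_assoc, ← Finset.mul_sum]
        rw [← hε1, ← hψe, mul_one, sub_self])
  -- a unit coordinate of `1`
  have hex : ∃ s₀, ¬ O.valuation (ε s₀ * W s₀) < 1 := by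
    by_contra hall
    push Not at hall
    have := O.valuation.map_sum_lt one_ne_zero (fun s (_ : s ∈ Finset.univ) => hall s)
    rw [← hε1, map_one] at this
    exact lt_irrefl _ this
  obtain ⟨s₀, hs₀⟩ := hex
  rw [map_mul, hWv, mul_one, not_lt] at hs₀
  have hε1v : O.valuation (ε s₀) = 1 :=
    le_antisymm ((O.valuation_le_one_iff _).mpr (hS₀O (hεS s₀))) hs₀
  have hunit : IsUnit (⟨ε s₀, hεS s₀⟩ : (locAtCentre A₀.toSubring O)) := by
    by_contra hnu
    exact absurd hε1v (ne_of_lt ((not_isUnit_locAtCentre_iff hA₀O _).mp hnu))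
  have hmem : ψ₀ * ⟨ε s₀, hεS s₀⟩ ∈ (IsLocalRing.maximalIdeal (locAtCentre A₀.toSubring O)) ^ 2 := by
    have heq : ψ₀ * ⟨ε s₀, hεS s₀⟩ = e s₀ := Subtype.ext (by
      have := hdiff s₀
      rw [sub_eq_zero] at this
      exact this.symm)
    rw [heq]; exact he2 s₀
  obtain ⟨w, hw⟩ := hunit
  apply hψ2
  have : ψ₀ = ψ₀ * ⟨ε s₀, hεS s₀⟩ * ↑w⁻¹ := by rw [← hw, mul_assoc, Units.mul_inv, mul_one]
  rw [this]
  exact Ideal.mul_mem_right _ _ hmem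

end FrameLayer2

end Summit.ResolutionOfSingularities.ResolutionOfSingularities.Theorems.RadicialJungCleanModels.Lens5TFrame

end
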